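import Summits.BirchSwinnertonDyer.BirchSwinnertonDyer.Theses.UniversalToricDescent
import Summits.BirchSwinnertonDyer.BirchSwinnertonDyer.Theorems.UniversalToricDescentOneLayerCriterion
import Summits.BirchSwinnertonDyer.Rank1Residual.X11b.AnticyclotomicModuleFinite
import Literature.NumberTheory.EllipticCurves.KatoFineSelmerDual
import HarnessLib

/-!
# Crux r205 `TwinAlgMuZeroAtThree` (stmt-BirchSwinnertonDyer-24737) — node `universal-norm-defect` (crux-ideate g12, 2026-08-31)

**THE MOVE (universal norms at the bottom).**  On the `𝔽₃`-space `V = Sel_(∅,0)(K_∞, E′[3^∞])[3]`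
(`selmerAc (W′/K) 3 κ 𝔭′ ∅`, `3`-torsion) the operator `N = conj_γ − 1` is locally nilpotent and, in characteristic `3`,
the NORM from layer `m` to layer `0` is `1 + γ + ⋯ + γ^{3^m−1} = (γ − 1)^{3^m−1} = N^{3^m−1}` on the `γ^{3^m}`-invariants
`ker N^{3^m}`.  Writing the Pontryagin dual `V^∨ ≅ Ω^r ⊕ (finite)`, `Ω = 𝔽₃⟦T⟧`, the space of UNIVERSAL NORMS in the bottom
layer, `U := ⋂ₘ N^{3^m−1}(ker N^{3^m}) ⊆ ker N`, has `dim U = r = rank_Λ X_(∅,0) + #{μ-summands of X_(∅,0)}`: the crux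
instance at `(W′, K, κ, 𝔭′)` says EXACTLY `U = 0`, i.e. (once the bottom invariants `ker N` are finite) «for some `m`, NO
non-zero `γ`-invariant residual Selmer class over `K_∞` is a norm from layer `m`» — a statement decided level by level by the
generalized BOCKSTEIN maps / Massey products `⟨χ, …, χ, ·⟩` of the tower [LLSWW, arXiv:2004.11510; Ray–Sujatha 2025,
arXiv:2508.17156, Thm. 1 and §6 (the FINE part, in print)] and by Bertolini–Darmon/Howard DERIVED HEIGHTS (`S^{(∞)}` = universal
norms; `h^{(i)}` perfect on `S^{(i)}/S^{(i+1)}`) [Howard 2004 «Derived p-adic heights»; CHKLL arXiv:2308.10474 Thm. 3.2, §1.5].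

**What is PROVED here (pure algebra on the route's own object, both buckets, any `p`).**
§1 `finite_ker_pow_of_finite_ker`, `finite_of_ker_pow_eq_succ`, `finite_of_pow_pred_vanishes_on_ker_pow`: for a locally nilpotent
`N` on a vector space with `ker N` finite, if `N^{M−1}` kills `ker N^M` for one `M ≥ 1` then the space is finite;
`exists_pow_eq_zero_of_finite`: the converse direction.  §2 ON THE ROUTE OBJECT: `finite_pTorsion_of_bottomNorms`
(finite `γ`-invariants in `Sel[p]` ∧ norms from ONE layer vanish on the bottom ⟹ `Sel[p]` finite) and its converse
`bottomNorms_of_finite_pTorsion` — so the pair (B1, B2) below is EQUIVALENT to the crux instance (certificate `bottom_of_crux`);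
`bottomNorms_of_cyclic_bottom`: when the bottom invariants are the multiples of ONE class `z` (the residual Heegner class on
pairs with `dim Sel_(∅,0)(K, E′[3]) = 1`), B2 at that datum follows from «`z` is not a norm from layer `m`» for ONE `m` — the typed
form of the card's child (ii-2).
§4 the Poitou–Tate CUT `0 → Q_𝔭′… → X_(∅,0) → X_fine → 0` read residually: `finite_torsionBy_of_fine_of_modFine` (FINE‴ ∧ QUOT‴ ⟹
`Sel[3]` finite), pure subgroup algebra.

**Pieces and tags (D-0171).**
* B1 `BottomInvariantsFiniteAtThree` — the `γ`-invariants of `Sel_(∅,0)(K_∞, E′[3^∞])[3]` are finite.  WEAKER than the crux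
  (`bottom_of_crux`); CLOSED — a theorem of the tree (`bottomInvariantsFiniteAtThree_holds` := the Summit-side
  `AcSelmer.finite_selmerAc_empty_pTorsion_invariants`, Greenberg's "`X/𝔪X` finite" for Castella's Selmer group; no crux hypothesis used).
* B2 `BottomNormsVanishAtThree` — for some `m`, `N^{3^m−1}` kills the `γ^{3^m}`-invariants of `Sel[3]` («no bottom class is a norm
  from layer `m`», `U = 0`).  EQUIVALENT to the crux (`TwinAlgMuZeroAtThree_iff_bottomNormsVanish`, kernel-checked) · UNDECIDED;
  children: the decomposition FINE‴ ∧ QUOT‴ (§3–4, typed, glue PROVED) and, in `Lines/universal_norm_defect.md`, the Heegner-vs-universal-norm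
  pair (ii-1)/(ii-2) and the residual derived Gross–Zagier leaf (IDEA-NEEDED).
* FINE‴ `FineSelmerThreeTorsionFiniteAtThree` — verbatim the piece of node `fine-selmer-cut` (g8): WEAKER; engines Wuthrich / class groups /
  NEW: Ray–Sujatha 2025 Thm. 3.6–3.8 + Cor. 3.7 (one-layer `H²(G_{K_n,S}, E′[3]) = 0` ⟹ FINE‴; honest: for rank-one pairs with
  `Ш(E′/K)[3] = 0` and no local `3`-torsion at `ℓ ∣ N′` this is the `t = 0` (UnitPairs) regime) and Thm. 1 (Massey spanning ⟺ FINE‴).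
* QUOT‴ `SelmerModFineThreeTorsionFiniteAtThree` — `Sel_(∅,0)[3]` is finite MODULO `Sel₀`: the `𝔭′`-VISIBLE part
  `Q = H¹_Iw(K_{∞,𝔭}, T)/loc(H¹_{Iw,rel})` of `X_(∅,0)` is torsion with `μ = 0` («two-row explicit reciprocity»).  WEAKER; UNDECIDED.
`TwinAlgMuZeroAtThree_of : B2 → crux` (B1 discharged in-tree), `TwinAlgMuZeroAtThree_iff_bottomNormsVanish : crux ↔ B2` and
`TwinAlgMuZeroAtThree_of_cut : FINE‴ → QUOT‴ → crux` conclude the crux BY NAME; `sorry` ONLY inside the three `stub_*`.  **Disproof used:** honours `twinAlgMuZeroAtThree_false_without_heegner`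
(the Heegner hypothesis is consumed by the children (ii-1)/(ii-2) and by the derived-height leaf, not by the algebra); no stub is an
instance of a landed Negative lemma (negatives 24881, 15532: adjoint / Beilinson–Flach lines).  BSD is proved for no curve by this file.

**SQUARE LEMMA (v3 addendum, informal; proof on paper in `Lines/universal_norm_defect.md` §(SQ) from Howard, Derived p-adic heights,
Lemma 2.10 / Thm 2.11 / Def 3.2).**  With `τ` = complex conjugation (`Sel_(∅,0) → Sel_(0,∅)`, `γ ↦ γ⁻¹`) the forms
`b_r(u,v) := h^{(r)}_q(u, τv)` on Howard's filtration `S^{(r)} ⊆ V^Γ` are ALL ALTERNATING (swap sign `(−1)^{r−1}` for the Weil pairing times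
τ-transport sign `(−1)^r`), with radical `S^{(r+1)}`.  Hence every graded piece `S^{(r)}/S^{(r+1)}` and `U = S^{(∞)}` is even-dimensional:
`X_(∅,0)/3X ≅ Y ⊕ Y` as `𝔽₃⟦T⟧`-modules, `rank (X/3X) ∈ 2ℕ`, and in characteristic 0 `X_(∅,0) ∼ N ⊕ N` — the structural square root of
`char X_(∅,0) = (ℒ^{BDP})²`.  Consequences for B2: on `t ≥ 1` data `dim V^Γ = 2`, `V^Γ = ⟨ȳ_K, x̄⟩` (PREDICTION: `Sel_(∅,0)(K, E′[3^∞]) ≅ (ℤ/3^t)²`),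
all diagonal values `h^{(r)}(ȳ_K, τȳ_K)` vanish, and the crux instance ⟺ `∃ r, h^{(r)}_q(ȳ_K, τx̄) ≠ 0` (one off-diagonal value, localised at `𝔭̄`);
the only failure mode is `rank (X/3X) = 2`.  The one-generator reduction `bottomNorms_of_cyclic_bottom` (§2) therefore addresses configurations
the square lemma predicts to be empty; its two-generator analogue is «some class of `V^Γ` is not a norm from layer `m`» = B2 itself.
[cite: Howard2004DerivedHeights, Lemma 2.10, Thm. 2.11, Def. 3.2 (arXiv:1202.6343 pp. 6, 8, 13)]
-/

noncomputable section

open scoped Classical NumberField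

set_option linter.dupNamespace false
set_option autoImplicit false

namespace Summit.BirchSwinnertonDyer.BirchSwinnertonDyer.Cruxes.TwinAlgMuZeroAtThree.UniversalNormDefect

/-! ## §1 Linear algebra: locally nilpotent operators with finite kernel -/

section LinearAlgebra

open Summit.BirchSwinnertonDyer.BirchSwinnertonDyer.Theorems.UniversalToricDescentOneLayerCriterion

variable {k : Type*} [Field k] {V : Type*} [AddCommGroup V] [Module k V]

/-- If `ker N` is finite then every `ker N^i` is finite (`N : ker N^{i+1} → ker N^i` has kernel inside `ker N`). [folklore] -/
theorem finite_ker_pow_of_finite_ker (N : V →ₗ[k] V) [hfin : Finite (LinearMap.ker N)] :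
    ∀ i : ℕ, Finite (LinearMap.ker (N ^ i))
  | 0 => by
    -- `ker N^0 = ker 1 = 0`
    have key : ∀ x : V, (N ^ 0) x = x := fun x => by rw [pow_zero, Module.End.one_apply]
    haveI : Subsingleton (LinearMap.ker (N ^ 0)) := by
      refine ⟨fun a b => Subtype.ext ?_⟩
      have ha : (a : V) = 0 := (key (a : V)).symm.trans (LinearMap.mem_ker.mp a.2)
      have hb : (b : V) = 0 := (key (b : V)).symm.trans (LinearMap.mem_ker.mp b.2)
      rw [ha, hb]
    infer_instance
  | i + 1 => by
    haveI : Finite (LinearMap.ker (N ^ i)) := finite_ker_pow_of_finite_ker N i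
    -- the map `v ↦ N v : ker N^{i+1} → ker N^i`
    have key : ∀ x : V, (N ^ (i + 1)) x = (N ^ i) (N x) := fun x => by
      rw [pow_succ, Module.End.mul_apply]
    let f : LinearMap.ker (N ^ (i + 1)) →+ LinearMap.ker (N ^ i) :=
      { toFun := fun v => ⟨N (v : V), LinearMap.mem_ker.mpr ((key (v : V)).symm.trans (LinearMap.mem_ker.mp v.2))⟩
        map_zero' := Subtype.ext (by simp)
        map_add' := fun v w => Subtype.ext (by simp) }
    haveI : Finite f.ker := by
      refine Finite.of_injective
        (fun v : f.ker => (⟨((v : LinearMap.ker (N ^ (i + 1))) : V), ?_⟩ : LinearMap.ker N)) ?_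
      · have hv : f (v : LinearMap.ker (N ^ (i + 1))) = 0 := (AddMonoidHom.mem_ker).mp v.2
        have hv' : ((f (v : LinearMap.ker (N ^ (i + 1))) : LinearMap.ker (N ^ i)) : V) = ((0 : LinearMap.ker (N ^ i)) : V) :=
          congrArg Subtype.val hv
        exact LinearMap.mem_ker.mpr hv'
      · intro a b hab
        have h1 : (((a : f.ker) : LinearMap.ker (N ^ (i + 1))) : V) = (((b : f.ker) : LinearMap.ker (N ^ (i + 1))) : V) := by
          simp only [Subtype.mk.injEq] at hab
          exact hab
        exact Subtype.ext (Subtype.ext h1)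
    letI : Fintype f.ker := Fintype.ofFinite _
    letI : Fintype (LinearMap.ker (N ^ i)) := Fintype.ofFinite _
    exact (AddGroup.fintypeOfKerOfCodom f).finite

/-- Locally nilpotent `N` with `ker N` finite: once two consecutive kernels agree, the whole space is finite. [folklore] -/
theorem finite_of_ker_pow_eq_succ (N : V →ₗ[k] V) (hnil : ∀ v : V, ∃ i : ℕ, (N ^ i) v = 0)
    [Finite (LinearMap.ker N)] {j : ℕ} (h : LinearMap.ker (N ^ j) = LinearMap.ker (N ^ (j + 1))) : Finite V := by
  haveI : Finite (LinearMap.ker (N ^ j)) := finite_ker_pow_of_finite_ker N j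
  have hall : ∀ v : V, v ∈ LinearMap.ker (N ^ j) := fun v => by
    obtain ⟨i, hi⟩ := hnil v
    have hvi : v ∈ LinearMap.ker (N ^ (j + i)) := ker_pow_mono N (Nat.le_add_left i j) (LinearMap.mem_ker.mpr hi)
    rw [ker_pow_add_eq_of_ker_pow_eq N h i] at hvi
    exact hvi
  exact Finite.of_injective (fun v : V => (⟨v, hall v⟩ : LinearMap.ker (N ^ j))) fun v w hvw => by
    simpa using congrArg Subtype.val hvw

/-- **Norm criterion (abstract).** Locally nilpotent `N`, `ker N` finite, and for ONE `M ≥ 1` the power `N^{M−1}` kills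
`ker N^M`: then the space is finite.  (With `M = p^m` in characteristic `p`, `N^{p^m−1}` restricted to `ker N^{p^m}` is the norm
map from layer `m` to layer `0`.) [folklore] -/
theorem finite_of_pow_pred_vanishes_on_ker_pow (N : V →ₗ[k] V) (hnil : ∀ v : V, ∃ i : ℕ, (N ^ i) v = 0)
    [Finite (LinearMap.ker N)] {M : ℕ} (hM : 1 ≤ M)
    (h : ∀ v : V, (N ^ M) v = 0 → (N ^ (M - 1)) v = 0) : Finite V := by
  refine finite_of_ker_pow_eq_succ N hnil (j := M - 1) (le_antisymm (ker_pow_mono N (Nat.le_succ _)) ?_)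
  intro v hv
  rw [Nat.sub_add_cancel hM] at hv
  exact LinearMap.mem_ker.mpr (h v (LinearMap.mem_ker.mp hv))

/-- Converse direction: on a FINITE space a locally nilpotent operator is nilpotent. [folklore] -/
theorem exists_pow_eq_zero_of_finite (N : V →ₗ[k] V) (hnil : ∀ v : V, ∃ i : ℕ, (N ^ i) v = 0) [Finite V] :
    ∃ n : ℕ, ∀ v : V, (N ^ n) v = 0 := by
  classical
  haveI : Fintype V := Fintype.ofFinite V
  choose i hi using hnil
  refine ⟨Finset.univ.sup i, fun v => ?_⟩
  have hle : i v ≤ Finset.univ.sup i := Finset.le_sup (Finset.mem_univ v)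
  exact LinearMap.mem_ker.mp (ker_pow_mono N hle (LinearMap.mem_ker.mpr (hi v)))

end LinearAlgebra

/-! ## §2 The bottom universal-norm criterion on Castella's anticyclotomic Selmer group (both directions) -/

section Selmer

open NumberField IsDedekindDomain Field Literature.NumberTheory.EllipticCurves
  Summit.BirchSwinnertonDyer.Rank1Residual.X11b Summit.BirchSwinnertonDyer.Rank1Residual.X11b.AcSelmer
  Summit.BirchSwinnertonDyer.BirchSwinnertonDyer.Theorems.UniversalToricDescentAcDualMuZero
  Summit.BirchSwinnertonDyer.BirchSwinnertonDyer.Theorems.UniversalToricDescentOneLayerCriterion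

universe u

variable {K : Type u} [Field K] [NumberField K] (W : WeierstrassCurve K) (p : ℕ) [hp : Fact p.Prime]
  (κ : ZpExtension K p) (𝔭 : HeightOneSpectrum (𝓞 K)) (S : Set (HeightOneSpectrum (𝓞 K)))
  (γ : absoluteGaloisGroup K) [hγ : Fact (κ.IsTopGenerator γ)]

/-- **BOTTOM UNIVERSAL-NORM CRITERION.**  If the `γ`-invariant classes of `Sel_𝔭^Σ(K_∞, E[p^∞])[p]` are finite and, for
ONE `m`, the norm operator `(conj_γ − 1)^{p^m − 1}` kills every `γ^{p^m}`-invariant class of `Sel[p]` (no non-zero bottom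
class is a norm from layer `m`), then ALL of `Sel[p]` is finite. [cite: GreenbergLNM1716, §1 (p. 60)] [folklore] -/
theorem finite_pTorsion_of_bottomNorms
    (hfix : Set.Finite {s : selmerAc W p κ 𝔭 S | p • s = 0 ∧ W.conjH1 p κ.kerSubgroup γ s = s})
    (hnorm : ∃ m : ℕ, ∀ s : selmerAc W p κ 𝔭 S, p • s = 0 →
      W.conjH1 p κ.kerSubgroup (γ ^ p ^ m) s = s → ((conjSelmerAc W p κ 𝔭 S γ - 1) ^ (p ^ m - 1)) s = 0) :
    Set.Finite {s : selmerAc W p κ 𝔭 S | p • s = 0} := by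
  -- the `𝔽_p`-space `V = Sel[p]` and `N = conj_γ − 1` on it, exactly as in the tree's one-layer criterion
  let Vsub : AddSubgroup (selmerAc W p κ 𝔭 S) := AddSubgroup.torsionBy (selmerAc W p κ 𝔭 S) (p : ℕ)
  have hmemV : ∀ s : selmerAc W p κ 𝔭 S, s ∈ Vsub ↔ p • s = 0 := fun s => AddSubgroup.torsionBy.nsmul_iff
  letI : Module (ZMod p) Vsub := AddSubgroup.torsionBy.zmodModule
  let ψ : AddMonoid.End (selmerAc W p κ 𝔭 S) := conjSelmerAc W p κ 𝔭 S γ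
  have hψV : ∀ v : Vsub, ψ (v : selmerAc W p κ 𝔭 S) ∈ Vsub := fun v => by
    rw [hmemV, ← map_nsmul, (hmemV _).mp v.2, map_zero]
  let φadd : Vsub →+ Vsub :=
    { toFun := fun v => ⟨ψ (v : selmerAc W p κ 𝔭 S), hψV v⟩
      map_zero' := Subtype.ext (map_zero ψ)
      map_add' := fun v w => Subtype.ext (map_add ψ _ _) }
  let φ : Vsub →ₗ[ZMod p] Vsub := φadd.toZModLinearMap p
  have hφpow : ∀ (i : ℕ) (v : Vsub), (((φ ^ i) v : Vsub) : selmerAc W p κ 𝔭 S) = (ψ ^ i) (v : selmerAc W p κ 𝔭 S) := by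
    intro i
    induction i with
    | zero => intro v; rfl
    | succ i ih =>
      intro v
      rw [pow_succ, Module.End.mul_apply, pow_succ, AddMonoid.End.coe_mul, Function.comp_apply, ih (φ v)]
      rfl
  set N : Vsub →ₗ[ZMod p] Vsub := φ - 1 with hN
  have hNpow : ∀ (i : ℕ) (v : Vsub),
      (((N ^ i) v : Vsub) : selmerAc W p κ 𝔭 S) = ((ψ - 1) ^ i) (v : selmerAc W p κ 𝔭 S) := by
    intro i
    induction i with
    | zero => intro v; rfl
    | succ i ih =>
      intro v
      rw [pow_succ, Module.End.mul_apply, pow_succ, AddMonoid.End.coe_mul, Function.comp_apply, ih (N v)]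
      rfl
  have hnil : ∀ v : Vsub, ∃ i : ℕ, (N ^ i) v = 0 := by
    intro v
    obtain ⟨i, hi⟩ := (isLocNil_conjSelmerAc_sub_one W p κ 𝔭 S hγ.out).nil (v : selmerAc W p κ 𝔭 S)
    exact ⟨i, Subtype.ext (by rw [hNpow]; exact hi)⟩
  -- `ker N^{pⁿ}` = the layer-`n` invariants in `Sel[p]`
  have hker : ∀ (n : ℕ) (v : Vsub), v ∈ LinearMap.ker (N ^ p ^ n) ↔
      W.conjH1 p κ.kerSubgroup (γ ^ p ^ n) (v : selmerAc W p κ 𝔭 S) = (v : selmerAc W p κ 𝔭 S) := by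
    intro n v
    rw [LinearMap.mem_ker, hN, sub_one_pow_prime_pow, LinearMap.sub_apply, sub_eq_zero, Module.End.one_apply,
      Subtype.ext_iff, Subtype.ext_iff, hφpow, coe_conjSelmerAc_pow_apply]
  -- `ker N` = the `γ`-invariants, finite by `hfix`
  have hker1 : ∀ v : Vsub, v ∈ LinearMap.ker N ↔
      W.conjH1 p κ.kerSubgroup γ (v : selmerAc W p κ 𝔭 S) = (v : selmerAc W p κ 𝔭 S) := by
    intro v
    have h := hker 0 v
    rwa [pow_zero, pow_one, pow_one] at h
  haveI : Finite {s : selmerAc W p κ 𝔭 S // p • s = 0 ∧ W.conjH1 p κ.kerSubgroup γ s = s} := hfix.to_subtype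
  haveI : Finite (LinearMap.ker N) :=
    Finite.of_injective (fun v : LinearMap.ker N =>
      (⟨((v : Vsub) : selmerAc W p κ 𝔭 S), (hmemV _).mp (v : Vsub).2, (hker1 _).mp v.2⟩ :
        {s : selmerAc W p κ 𝔭 S // p • s = 0 ∧ W.conjH1 p κ.kerSubgroup γ s = s}))
      fun v w hvw => by
        have h1 : (((v : LinearMap.ker N) : Vsub) : selmerAc W p κ 𝔭 S) = (((w : LinearMap.ker N) : Vsub) : selmerAc W p κ 𝔭 S) := by
          simp only [Subtype.mk.injEq] at hvw
          exact hvw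
        exact Subtype.ext (Subtype.ext h1)
  -- the norm hypothesis, transported to `N`
  obtain ⟨m, hm⟩ := hnorm
  have hM : 1 ≤ p ^ m := Nat.one_le_iff_ne_zero.mpr (pow_ne_zero m hp.out.ne_zero)
  have hstep : ∀ v : Vsub, (N ^ p ^ m) v = 0 → (N ^ (p ^ m - 1)) v = 0 := by
    intro v hv
    have hinv := (hker m v).mp (LinearMap.mem_ker.mpr hv)
    have h0 := hm (v : selmerAc W p κ 𝔭 S) ((hmemV _).mp v.2) hinv
    exact Subtype.ext (by rw [hNpow]; exact h0)
  haveI : Finite Vsub := finite_of_pow_pred_vanishes_on_ker_pow N hnil hM hstep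
  -- `Sel[p] = V`
  have : {s : selmerAc W p κ 𝔭 S | p • s = 0} = Set.range (fun v : Vsub => (v : selmerAc W p κ 𝔭 S)) := by
    ext s
    simp only [Set.mem_setOf_eq, Set.mem_range]
    constructor
    · exact fun hs => ⟨⟨s, (hmemV s).mpr hs⟩, rfl⟩
    · rintro ⟨v, rfl⟩; exact (hmemV _).mp v.2
  rw [this]
  exact Set.finite_range _

/-- **Converse**: if `Sel[p]` is finite then the `γ`-invariants are finite and the norm operator of SOME layer kills all of
`Sel[p]` (a locally nilpotent operator on a finite space is nilpotent, and `p^m − 1 ≥ m`).  Together with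
`finite_pTorsion_of_bottomNorms`: the bottom universal-norm conditions are EQUIVALENT to the finiteness of `Sel[p]`. [folklore] -/
theorem bottomNorms_of_finite_pTorsion (hfin : Set.Finite {s : selmerAc W p κ 𝔭 S | p • s = 0}) :
    Set.Finite {s : selmerAc W p κ 𝔭 S | p • s = 0 ∧ W.conjH1 p κ.kerSubgroup γ s = s} ∧
      ∃ m : ℕ, ∀ s : selmerAc W p κ 𝔭 S, p • s = 0 →
        W.conjH1 p κ.kerSubgroup (γ ^ p ^ m) s = s → ((conjSelmerAc W p κ 𝔭 S γ - 1) ^ (p ^ m - 1)) s = 0 := by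
  refine ⟨hfin.subset fun s hs => hs.1, ?_⟩
  -- `V = Sel[p]`, `N = conj_γ − 1`
  let Vsub : AddSubgroup (selmerAc W p κ 𝔭 S) := AddSubgroup.torsionBy (selmerAc W p κ 𝔭 S) (p : ℕ)
  have hmemV : ∀ s : selmerAc W p κ 𝔭 S, s ∈ Vsub ↔ p • s = 0 := fun s => AddSubgroup.torsionBy.nsmul_iff
  letI : Module (ZMod p) Vsub := AddSubgroup.torsionBy.zmodModule
  let ψ : AddMonoid.End (selmerAc W p κ 𝔭 S) := conjSelmerAc W p κ 𝔭 S γ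
  have hψV : ∀ v : Vsub, ψ (v : selmerAc W p κ 𝔭 S) ∈ Vsub := fun v => by
    rw [hmemV, ← map_nsmul, (hmemV _).mp v.2, map_zero]
  let φadd : Vsub →+ Vsub :=
    { toFun := fun v => ⟨ψ (v : selmerAc W p κ 𝔭 S), hψV v⟩
      map_zero' := Subtype.ext (map_zero ψ)
      map_add' := fun v w => Subtype.ext (map_add ψ _ _) }
  let φ : Vsub →ₗ[ZMod p] Vsub := φadd.toZModLinearMap p
  set N : Vsub →ₗ[ZMod p] Vsub := φ - 1 with hN
  have hNpow : ∀ (i : ℕ) (v : Vsub),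
      (((N ^ i) v : Vsub) : selmerAc W p κ 𝔭 S) = ((ψ - 1) ^ i) (v : selmerAc W p κ 𝔭 S) := by
    intro i
    induction i with
    | zero => intro v; rfl
    | succ i ih =>
      intro v
      rw [pow_succ, Module.End.mul_apply, pow_succ, AddMonoid.End.coe_mul, Function.comp_apply, ih (N v)]
      rfl
  have hnil : ∀ v : Vsub, ∃ i : ℕ, (N ^ i) v = 0 := by
    intro v
    obtain ⟨i, hi⟩ := (isLocNil_conjSelmerAc_sub_one W p κ 𝔭 S hγ.out).nil (v : selmerAc W p κ 𝔭 S)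
    exact ⟨i, Subtype.ext (by rw [hNpow]; exact hi)⟩
  haveI : Finite {s : selmerAc W p κ 𝔭 S // p • s = 0} := hfin.to_subtype
  haveI : Finite Vsub :=
    Finite.of_injective (fun v : Vsub => (⟨(v : selmerAc W p κ 𝔭 S), (hmemV _).mp v.2⟩ :
      {s : selmerAc W p κ 𝔭 S // p • s = 0})) fun v w hvw => by
        have h1 : ((v : Vsub) : selmerAc W p κ 𝔭 S) = ((w : Vsub) : selmerAc W p κ 𝔭 S) := by
          simp only [Subtype.mk.injEq] at hvw
          exact hvw
        exact Subtype.ext h1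
  obtain ⟨n, hn⟩ := exists_pow_eq_zero_of_finite N hnil
  refine ⟨n, fun s hs _ => ?_⟩
  -- `p^n − 1 ≥ n`, so `N^{p^n − 1}` kills everything
  have hle : n ≤ p ^ n - 1 := Nat.le_sub_one_of_lt (Nat.lt_pow_self hp.out.one_lt)
  have hv := LinearMap.mem_ker.mp (ker_pow_mono N hle (LinearMap.mem_ker.mpr (hn ⟨s, (hmemV s).mpr hs⟩)))
  have h := hNpow (p ^ n - 1) ⟨s, (hmemV s).mpr hs⟩
  rw [hv] at h
  -- `h : ↑(0 : Vsub) = ((ψ - 1) ^ (p ^ n - 1)) s`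
  have h0 : (((0 : Vsub) : selmerAc W p κ 𝔭 S)) = 0 := rfl
  rw [h0] at h
  exact h.symm

omit hγ in
/-- **ONE GENERATOR, ONE NON-NORM CERTIFICATE.**  If the `γ`-invariant classes of `Sel[p]` are the multiples of ONE class
`z` (e.g. the residual Heegner class when `dim Sel_(∅,0)(K, E′[3]) = 1` and residual control is exact), and for SOME `m` the
class `z` is NOT of the form `(conj_γ − 1)^{p^m − 1} v` with `v` a `γ^{p^m}`-invariant class of `Sel[p]` («`z` is not a norm from
layer `m`»), then the norm operator of layer `m` kills ALL `γ^{p^m}`-invariants of `Sel[p]` — hypothesis B2 at this datum.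
(The image of the norm operator lies in the line `⟨z⟩` and misses `z`, hence is `0`.) [folklore]
[cite: Howard2004DerivedHeights, Thm. A (shape: universal norms and derived heights)] -/
theorem bottomNorms_of_cyclic_bottom (z : selmerAc W p κ 𝔭 S) (hz : p • z = 0)
    (hcyc : ∀ s : selmerAc W p κ 𝔭 S, p • s = 0 → W.conjH1 p κ.kerSubgroup γ s = s → ∃ c : ℕ, s = c • z)
    {m : ℕ} (hnot : ∀ v : selmerAc W p κ 𝔭 S, p • v = 0 → W.conjH1 p κ.kerSubgroup (γ ^ p ^ m) v = v →
      ((conjSelmerAc W p κ 𝔭 S γ - 1) ^ (p ^ m - 1)) v ≠ z) :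
    ∀ s : selmerAc W p κ 𝔭 S, p • s = 0 →
      W.conjH1 p κ.kerSubgroup (γ ^ p ^ m) s = s → ((conjSelmerAc W p κ 𝔭 S γ - 1) ^ (p ^ m - 1)) s = 0 := by
  -- the `𝔽_p`-space `V = Sel[p]` and `N = conj_γ − 1` on it (as in `finite_pTorsion_of_bottomNorms`)
  let Vsub : AddSubgroup (selmerAc W p κ 𝔭 S) := AddSubgroup.torsionBy (selmerAc W p κ 𝔭 S) (p : ℕ)
  have hmemV : ∀ s : selmerAc W p κ 𝔭 S, s ∈ Vsub ↔ p • s = 0 := fun s => AddSubgroup.torsionBy.nsmul_iff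
  letI : Module (ZMod p) Vsub := AddSubgroup.torsionBy.zmodModule
  let ψ : AddMonoid.End (selmerAc W p κ 𝔭 S) := conjSelmerAc W p κ 𝔭 S γ
  have hψV : ∀ v : Vsub, ψ (v : selmerAc W p κ 𝔭 S) ∈ Vsub := fun v => by
    rw [hmemV, ← map_nsmul, (hmemV _).mp v.2, map_zero]
  let φadd : Vsub →+ Vsub :=
    { toFun := fun v => ⟨ψ (v : selmerAc W p κ 𝔭 S), hψV v⟩
      map_zero' := Subtype.ext (map_zero ψ)
      map_add' := fun v w => Subtype.ext (map_add ψ _ _) }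
  let φ : Vsub →ₗ[ZMod p] Vsub := φadd.toZModLinearMap p
  have hφpow : ∀ (i : ℕ) (v : Vsub), (((φ ^ i) v : Vsub) : selmerAc W p κ 𝔭 S) = (ψ ^ i) (v : selmerAc W p κ 𝔭 S) := by
    intro i
    induction i with
    | zero => intro v; rfl
    | succ i ih =>
      intro v
      rw [pow_succ, Module.End.mul_apply, pow_succ, AddMonoid.End.coe_mul, Function.comp_apply, ih (φ v)]
      rfl
  set N : Vsub →ₗ[ZMod p] Vsub := φ - 1 with hN
  have hNpow : ∀ (i : ℕ) (v : Vsub),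
      (((N ^ i) v : Vsub) : selmerAc W p κ 𝔭 S) = ((ψ - 1) ^ i) (v : selmerAc W p κ 𝔭 S) := by
    intro i
    induction i with
    | zero => intro v; rfl
    | succ i ih =>
      intro v
      rw [pow_succ, Module.End.mul_apply, pow_succ, AddMonoid.End.coe_mul, Function.comp_apply, ih (N v)]
      rfl
  have hker : ∀ (n : ℕ) (v : Vsub), v ∈ LinearMap.ker (N ^ p ^ n) ↔
      W.conjH1 p κ.kerSubgroup (γ ^ p ^ n) (v : selmerAc W p κ 𝔭 S) = (v : selmerAc W p κ 𝔭 S) := by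
    intro n v
    rw [LinearMap.mem_ker, hN, sub_one_pow_prime_pow, LinearMap.sub_apply, sub_eq_zero, Module.End.one_apply,
      Subtype.ext_iff, Subtype.ext_iff, hφpow, coe_conjSelmerAc_pow_apply]
  have hker1 : ∀ v : Vsub, v ∈ LinearMap.ker N ↔
      W.conjH1 p κ.kerSubgroup γ (v : selmerAc W p κ 𝔭 S) = (v : selmerAc W p κ 𝔭 S) := by
    intro v
    have h := hker 0 v
    rwa [pow_zero, pow_one, pow_one] at h
  have hM : 1 ≤ p ^ m := Nat.one_le_iff_ne_zero.mpr (pow_ne_zero m hp.out.ne_zero)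
  intro s hs hfix
  let v : Vsub := ⟨s, (hmemV s).mpr hs⟩
  have hvker : v ∈ LinearMap.ker (N ^ p ^ m) := (hker m v).mpr hfix
  -- `w := N^{p^m − 1} v` is `γ`-invariant: `N w = N^{p^m} v = 0`
  let w : Vsub := (N ^ (p ^ m - 1)) v
  have hNw : N w = 0 := by
    have h1 : (N ^ (p ^ m - 1 + 1)) v = 0 := by
      rw [Nat.sub_add_cancel hM]; exact LinearMap.mem_ker.mp hvker
    rw [pow_succ'] at h1
    exact h1
  have hwfix := (hker1 w).mp (LinearMap.mem_ker.mpr hNw)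
  have hwp : p • (w : selmerAc W p κ 𝔭 S) = 0 := (hmemV _).mp w.2
  -- hence `w = c • z`
  obtain ⟨c, hc⟩ := hcyc (w : selmerAc W p κ 𝔭 S) hwp hwfix
  have hwN : (w : selmerAc W p κ 𝔭 S) = ((ψ - 1) ^ (p ^ m - 1)) s := hNpow (p ^ m - 1) v
  by_cases hpc : p ∣ c
  · -- `c • z = (c/p) • (p • z) = 0`
    obtain ⟨d, rfl⟩ := hpc
    rw [mul_nsmul, hz, nsmul_zero] at hc
    rw [← hwN]; exact hc
  · -- `c` is invertible mod `p`: `d * c ≡ 1 (mod p)`, and then `d • v` is a norm preimage of `z` — contradiction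
    exfalso
    have hcop : Nat.Coprime c p := (Nat.coprime_comm).mp ((Nat.Prime.coprime_iff_not_dvd hp.out).mpr hpc)
    obtain ⟨d, -, hd⟩ := Nat.exists_mul_mod_eq_one_of_coprime hcop hp.out.one_lt
    -- the class `d • s`
    have hds : p • (d • s) = 0 := by rw [smul_comm, hs, smul_zero]
    have hdfix : W.conjH1 p κ.kerSubgroup (γ ^ p ^ m) (d • s) = d • s := by
      have h := (hker m (d • v)).mp (nsmul_mem hvker d)
      simpa using h
    apply hnot (d • s) hds hdfix
    -- `N^{p^m-1}(d • s) = d • w = (c * d) • z = z`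
    have h1 : ((ψ - 1) ^ (p ^ m - 1)) (d • s) = d • ((ψ - 1) ^ (p ^ m - 1)) s := map_nsmul _ _ _
    rw [h1, ← hwN, hc, ← mul_nsmul, ← Nat.div_add_mod (c * d) p, hd, add_nsmul, one_nsmul, mul_nsmul, hz,
      nsmul_zero, zero_add]

end Selmer

/-! ## §3 The pieces over the crux's binders (Props only; nothing asserted) -/

section Pieces

open NumberField IsDedekindDomain Field WeierstrassCurve
open Literature.NumberTheory.EllipticCurves Literature.NumberTheory.EllipticCurves.IwasawaAlgebra
open Literature.NumberTheory.EllipticCurves.ZpExtension Literature.NumberTheory.EllipticCurves.GreenbergSelmer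
open Summit.BirchSwinnertonDyer.Rank1Residual.X11b Summit.BirchSwinnertonDyer.Rank1Residual.X11b.AcSelmer
open Summit.BirchSwinnertonDyer.BirchSwinnertonDyer.Theorems
open Summit.BirchSwinnertonDyer.BirchSwinnertonDyer.Theorems.UniversalToricDescentAcDualMuZero
open Literature.NumberTheory.EllipticCurves.ModularForms (ModularParametrizationData)

/-- **B1 — the bottom `γ`-invariants of `Sel_(∅,0)(K_∞, E′[3^∞])[3]` are finite** (crux binders verbatim, both buckets).
TAG: WEAKER than the crux (`bottom_of_crux`) · CLOSED (`bottomInvariantsFiniteAtThree_holds`, from the tree theorem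
`AcSelmer.finite_selmerAc_empty_pTorsion_invariants`: Kummer lift to `H¹(K_∞, E′[3])`, finite kernel, descent of `γ`-invariant
classes unramified outside the bad set into the finite `H¹(G_K, E′[3]; S′)`, Silverman X.4.3).
[cite: GreenbergLNM1716, §1 p. 60 (after Conj. 1.3)] [cite: SilvermanAEC2009, Lemma X.4.3] -/
def BottomInvariantsFiniteAtThree : Prop :=
    ∀ (W' : WeierstrassCurve ℚ) [W'.IsElliptic] [W'.IsGloballyMinimal] (N' : ℕ) [NeZero N']
      (K : Type) [Field K] [NumberField K] (_Dt' : ModularParametrizationData W' N'),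
      (Rank1Residual.Mult W' 3 ∧ ¬ 3 ∣ padicValInt 3 W'.minimalDiscriminantInt ∨
        Rank1Residual.GoodSS W' 3 ∧ W'.frobeniusTrace 3 = 0) →
      W'.HasSurjectiveModNGaloisRep 3 → W'.conductorNorm ℤ = N' → IsImaginaryQuadratic K →
      SatisfiesHeegnerHypothesis N' K → Odd (NumberField.discr K) →
      ∀ (κ : ZpExtension K 3), κ.IsAnticyclotomic →
      ∀ (γ : absoluteGaloisGroup K) [Fact (κ.IsTopGenerator γ)]
        (𝔭 : HeightOneSpectrum (𝓞 K)), ((3 : ℕ) : 𝓞 K) ∈ 𝔭.asIdeal →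
        𝔭.asIdeal.ramificationIdx (𝓞 ℚ) = 1 → 𝔭.asIdeal.inertiaDeg (𝓞 ℚ) = 1 →
      ∀ (𝔭' : HeightOneSpectrum (𝓞 K)), ((3 : ℕ) : 𝓞 K) ∈ 𝔭'.asIdeal → 𝔭' ≠ 𝔭 →
      Set.Finite {s : selmerAc (W'.baseChange K) 3 κ 𝔭' ∅ |
        (3 : ℕ) • s = 0 ∧ (W'.baseChange K).conjH1 3 κ.kerSubgroup γ s = s}

/-- **B1 is a THEOREM OF THE TREE** (not a stub): `Sel_𝔭′(K_∞, E′[3^∞])[𝔪]` is finite for every elliptic curve, every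
`ℤ_p`-extension and every topological generator — Greenberg's "`X/𝔪X` is finite", assembled for Castella's Selmer group in
`Summit.BirchSwinnertonDyer.Rank1Residual.X11b.AcSelmer.finite_selmerAc_empty_pTorsion_invariants` (Kummer lift to
`H¹(K_∞, E′[3])`, unramifiedness outside the bad set, descent of `γ`-invariant classes into the finite `H¹(G_K, E′[3]; S′)`,
Silverman X.4.3).  None of the crux's arithmetic hypotheses is used.  TAG: WEAKER · CLOSED (in-tree).
[cite: GreenbergLNM1716, §1 p. 60 (after Conj. 1.3)] [cite: SilvermanAEC2009, Lemma X.4.3] -/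
theorem bottomInvariantsFiniteAtThree_holds : BottomInvariantsFiniteAtThree := by
  intro W' _ _ N' _ K _ _ _Dt' _hbucket _hsurj _hN _hK _hH _hodd κ _hκ γ hγ 𝔭 _h𝔭 _he _hf 𝔭' _h𝔭' _hne
  exact Summit.BirchSwinnertonDyer.Rank1Residual.X11b.AcSelmer.finite_selmerAc_empty_pTorsion_invariants
    (W := W'.baseChange K) (p := 3) κ (𝔭 := 𝔭') hγ.out


/-- **B2 — NO BOTTOM UNIVERSAL NORMS: for some `m`, the norm operator `(conj_γ − 1)^{3^m − 1}` kills every `γ^{3^m}`-invariant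
class of `Sel_(∅,0)(K_∞, E′[3^∞])[3]`** (crux binders verbatim, both buckets).  `dim` of the universal norms
`U = ⋂ₘ N^{3^m−1}(ker N^{3^m})` is `rank_Λ X_(∅,0) + #{μ-summands}`; B2 says `U = 0` at a finite level.
TAG: given B1, EQUIVALENT to the crux instance (`TwinAlgMuZeroAtThree_of`, `bottom_of_crux`) · UNDECIDED; decided level by level
by generalized Bockstein maps / Massey products `⟨χ,…,χ,·⟩` and by derived heights (children in the line card).
[cite: LLSWW2023HigherChernMassey, Thm. 1.1 (shape: generalized Bockstein ⟺ Iwasawa invariants)]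
[cite: RaySujatha2025MuFineSelmer, Thm. 1 and §6 (fine part, shape)] [cite: Howard2004DerivedHeights, Thm. A (universal norms = `S^{(∞)}`, shape)] -/
@[conjecture]
def BottomNormsVanishAtThree : Prop :=
    ∀ (W' : WeierstrassCurve ℚ) [W'.IsElliptic] [W'.IsGloballyMinimal] (N' : ℕ) [NeZero N']
      (K : Type) [Field K] [NumberField K] (_Dt' : ModularParametrizationData W' N'),
      (Rank1Residual.Mult W' 3 ∧ ¬ 3 ∣ padicValInt 3 W'.minimalDiscriminantInt ∨
        Rank1Residual.GoodSS W' 3 ∧ W'.frobeniusTrace 3 = 0) →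
      W'.HasSurjectiveModNGaloisRep 3 → W'.conductorNorm ℤ = N' → IsImaginaryQuadratic K →
      SatisfiesHeegnerHypothesis N' K → Odd (NumberField.discr K) →
      ∀ (κ : ZpExtension K 3), κ.IsAnticyclotomic →
      ∀ (γ : absoluteGaloisGroup K) [Fact (κ.IsTopGenerator γ)]
        (𝔭 : HeightOneSpectrum (𝓞 K)), ((3 : ℕ) : 𝓞 K) ∈ 𝔭.asIdeal →
        𝔭.asIdeal.ramificationIdx (𝓞 ℚ) = 1 → 𝔭.asIdeal.inertiaDeg (𝓞 ℚ) = 1 →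
      ∀ (𝔭' : HeightOneSpectrum (𝓞 K)), ((3 : ℕ) : 𝓞 K) ∈ 𝔭'.asIdeal → 𝔭' ≠ 𝔭 →
      ∃ m : ℕ, ∀ s : selmerAc (W'.baseChange K) 3 κ 𝔭' ∅, (3 : ℕ) • s = 0 →
        (W'.baseChange K).conjH1 3 κ.kerSubgroup (γ ^ (3 : ℕ) ^ m) s = s →
        ((conjSelmerAc (W'.baseChange K) 3 κ 𝔭' ∅ γ - 1) ^ ((3 : ℕ) ^ m - 1)) s = 0

/-- **FINE‴ — the `3`-torsion of the FINE Selmer group `Sel₀(K_∞, E′[3^∞])` is finite** — VERBATIM the piece of node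
`fine-selmer-cut` (crux-ideate g8, `Lines/fine_selmer_cut.lean`), repeated here so that this file does not import a `Lines/`
file; the normalised signature is identical (one item, two lines).  TAG: WEAKER than the crux; engines per twin: Wuthrich's Euler
characteristic [cite: Matar2018, Thm. 4.1], the tree's class-group criterion, and Ray–Sujatha's one-layer `H²`-vanishing
[cite: RaySujatha2025MuFineSelmer, Cor. 3.7 and Thm. 3.6] / Massey spanning [cite: RaySujatha2025MuFineSelmer, Thm. 1];
class-wide IDEA-NEEDED. [cite: CoatesSujatha2005, Conj. A] -/
@[conjecture]
def FineSelmerThreeTorsionFiniteAtThree : Prop :=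
    ∀ (W' : WeierstrassCurve ℚ) [W'.IsElliptic] [W'.IsGloballyMinimal] (N' : ℕ) [NeZero N']
      (K : Type) [Field K] [NumberField K] (_Dt' : ModularParametrizationData W' N'),
      (Rank1Residual.Mult W' 3 ∧ ¬ 3 ∣ padicValInt 3 W'.minimalDiscriminantInt ∨
        Rank1Residual.GoodSS W' 3 ∧ W'.frobeniusTrace 3 = 0) →
      W'.HasSurjectiveModNGaloisRep 3 → W'.conductorNorm ℤ = N' → IsImaginaryQuadratic K →
      SatisfiesHeegnerHypothesis N' K → Odd (NumberField.discr K) →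
      ∀ (κ : ZpExtension K 3), κ.IsAnticyclotomic →
      ∀ (γ : absoluteGaloisGroup K) [Fact (κ.IsTopGenerator γ)]
        (𝔭 : HeightOneSpectrum (𝓞 K)), ((3 : ℕ) : 𝓞 K) ∈ 𝔭.asIdeal →
        𝔭.asIdeal.ramificationIdx (𝓞 ℚ) = 1 → 𝔭.asIdeal.inertiaDeg (𝓞 ℚ) = 1 →
      ∀ (𝔭' : HeightOneSpectrum (𝓞 K)), ((3 : ℕ) : 𝓞 K) ∈ 𝔭'.asIdeal → 𝔭' ≠ 𝔭 →
      Set.Finite {s : (W'.baseChange K).fineSelmerInfty κ | (3 : ℕ) • s = 0}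

/-- **QUOT‴ — `Sel_(∅,0)(K_∞, E′[3^∞])[3]` is finite MODULO the fine Selmer group**: finitely many `3`-torsion classes of
Castella's Selmer group represent all of them up to a fine class killed by `3`.  By Poitou–Tate
(`0 → H¹_Iw,(0,∅)(T) → H¹_Iw,rel(T) → H¹_Iw(K_{∞,𝔭}, T) → X_(∅,0) → X_(0,0) → 0` read at the residual level) this is
«the `𝔭`-VISIBLE part `Q = H¹_Iw(K_{∞,𝔭}, T)/loc(H¹_Iw,rel(T))` of `X_(∅,0)` is `Λ`-torsion with `μ = 0`», i.e. a TWO-ROW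
explicit-reciprocity statement (the Heegner row is K1-type; the second row is the class `ξ` completing `κ_∞` to a basis of
the rank-two `H¹_Iw,rel`).  TAG: WEAKER than the crux (`modFine_of_crux`) · UNDECIDED; FINE‴ ∧ QUOT‴ ⟺ crux instance
(`TwinAlgMuZeroAtThree_of_cut`). [cite: MazurRubin2004, Thm. 2.3.4 (Poitou–Tate comparison of Selmer structures, shape)]
[cite: Castella2018, Def. 2.2] -/
@[conjecture]
def SelmerModFineThreeTorsionFiniteAtThree : Prop :=
    ∀ (W' : WeierstrassCurve ℚ) [W'.IsElliptic] [W'.IsGloballyMinimal] (N' : ℕ) [NeZero N']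
      (K : Type) [Field K] [NumberField K] (_Dt' : ModularParametrizationData W' N'),
      (Rank1Residual.Mult W' 3 ∧ ¬ 3 ∣ padicValInt 3 W'.minimalDiscriminantInt ∨
        Rank1Residual.GoodSS W' 3 ∧ W'.frobeniusTrace 3 = 0) →
      W'.HasSurjectiveModNGaloisRep 3 → W'.conductorNorm ℤ = N' → IsImaginaryQuadratic K →
      SatisfiesHeegnerHypothesis N' K → Odd (NumberField.discr K) →
      ∀ (κ : ZpExtension K 3), κ.IsAnticyclotomic →
      ∀ (γ : absoluteGaloisGroup K) [Fact (κ.IsTopGenerator γ)]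
        (𝔭 : HeightOneSpectrum (𝓞 K)), ((3 : ℕ) : 𝓞 K) ∈ 𝔭.asIdeal →
        𝔭.asIdeal.ramificationIdx (𝓞 ℚ) = 1 → 𝔭.asIdeal.inertiaDeg (𝓞 ℚ) = 1 →
      ∀ (𝔭' : HeightOneSpectrum (𝓞 K)), ((3 : ℕ) : 𝓞 K) ∈ 𝔭'.asIdeal → 𝔭' ≠ 𝔭 →
      ∃ F : Set ((W'.baseChange K).subgroupH1 3 κ.kerSubgroup), F.Finite ∧
        ∀ c : (W'.baseChange K).subgroupH1 3 κ.kerSubgroup, c ∈ selmerAc (W'.baseChange K) 3 κ 𝔭' ∅ →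
          (3 : ℕ) • c = 0 → ∃ f ∈ F, c - f ∈ (W'.baseChange K).fineSelmerInfty κ ∧ (3 : ℕ) • (c - f) = 0

end Pieces

/-! ## §4 The Poitou–Tate cut, residually: FINE‴ ∧ QUOT‴ ⟹ `Sel[3]` finite (pure subgroup algebra) -/

section Cut

/-- Pure algebra: if the `n`-torsion of a subgroup `B ≤ A` is finite and every `n`-torsion element of `C ≤ A` differs from an
element of a finite set `F` by an `n`-torsion element of `B`, then the `n`-torsion of `C` is finite. [folklore] -/
theorem finite_torsion_of_finite_modulo {A : Type*} [AddCommGroup A] (B C : AddSubgroup A) (n : ℕ)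
    (hB : Set.Finite {b : B | n • b = 0}) (F : Set A) (hF : F.Finite)
    (hmod : ∀ c : A, c ∈ C → n • c = 0 → ∃ f ∈ F, c - f ∈ B ∧ n • (c - f) = 0) :
    Set.Finite {s : C | n • s = 0} := by
  -- the `n`-torsion of `B`, seen in `A`
  let Bn : Set A := (fun b : B => (b : A)) '' {b : B | n • b = 0}
  have hBn : Bn.Finite := hB.image _
  -- every `n`-torsion class of `C` lies in a translate `f + Bn`, `f ∈ F`
  have hcover : (fun s : C => (s : A)) '' {s : C | n • s = 0} ⊆ ⋃ f ∈ F, (fun b : A => f + b) '' Bn := by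
    rintro _ ⟨s, hs, rfl⟩
    have hs' : n • (s : A) = 0 := by
      have h1 := congrArg Subtype.val hs
      simpa using h1
    obtain ⟨f, hfF, hB', hn'⟩ := hmod (s : A) s.2 hs'
    refine Set.mem_iUnion₂.mpr ⟨f, hfF, ⟨(s : A) - f, ⟨⟨(s : A) - f, hB'⟩, ?_, rfl⟩, ?_⟩⟩
    · show n • (⟨(s : A) - f, hB'⟩ : B) = 0
      exact Subtype.ext (by simpa using hn')
    · simp only [add_sub_cancel]
  have hfinU : (⋃ f ∈ F, (fun b : A => f + b) '' Bn).Finite :=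
    hF.biUnion fun f _ => hBn.image _
  exact Set.Finite.of_finite_image ((hfinU.subset hcover)) Subtype.coe_injective.injOn

open NumberField IsDedekindDomain Field WeierstrassCurve
open Literature.NumberTheory.EllipticCurves Literature.NumberTheory.EllipticCurves.IwasawaAlgebra
open Literature.NumberTheory.EllipticCurves.ZpExtension Literature.NumberTheory.EllipticCurves.GreenbergSelmer
open Summit.BirchSwinnertonDyer.Rank1Residual.X11b Summit.BirchSwinnertonDyer.Rank1Residual.X11b.AcSelmer
open Summit.BirchSwinnertonDyer.BirchSwinnertonDyer.Theorems
open Summit.BirchSwinnertonDyer.BirchSwinnertonDyer.Theorems.UniversalToricDescentAcDualMuZero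

/-- **`Sel₀(K_∞, E[p^∞]) ≤ Sel_𝔭^Σ(K_∞, E[p^∞])`** (the fine datum at `𝔭` IS Castella's strict datum) — as in node
`fine-selmer-cut`, repeated so that no `Lines/` file is imported. [cite: Greenberg1989, §1 p. 98] [cite: Castella2018, Def. 2.2] -/
theorem fineSelmerInfty_le_selmerAc {K : Type} [Field K] [NumberField K] (W : WeierstrassCurve K) (p : ℕ)
    [Fact p.Prime] (κ : ZpExtension K p) (𝔭 : HeightOneSpectrum (𝓞 K)) (h𝔭 : ((p : ℕ) : 𝓞 K) ∈ 𝔭.asIdeal)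
    (S : Set (HeightOneSpectrum (𝓞 K))) :
    W.fineSelmerInfty κ ≤ selmerAc W p κ 𝔭 S := by
  intro c hc
  have hc' := (mem_strictSelmerGroupOver_iff c).mp hc
  exact (mem_selmerOver_iff c).mpr
    ⟨fun v hv _ σ ↦ hc'.1 v hv σ, hc'.2.1, fun σ ↦ hc'.2.2 𝔭 h𝔭 σ⟩

/-- **FINE‴-instance ∧ QUOT‴-instance ⟹ `Sel_𝔭′(K_∞, E′[3^∞])[3]` finite** (the residual Poitou–Tate cut). [folklore] -/
theorem finite_torsionBy_of_fine_of_modFine {K : Type} [Field K] [NumberField K] (W : WeierstrassCurve K) (p : ℕ)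
    [Fact p.Prime] (κ : ZpExtension K p) (𝔭 : HeightOneSpectrum (𝓞 K)) (S : Set (HeightOneSpectrum (𝓞 K)))
    (hfine : Set.Finite {s : W.fineSelmerInfty κ | (p : ℕ) • s = 0})
    (hmod : ∃ F : Set (W.subgroupH1 p κ.kerSubgroup), F.Finite ∧
      ∀ c : W.subgroupH1 p κ.kerSubgroup, c ∈ selmerAc W p κ 𝔭 S → (p : ℕ) • c = 0 →
        ∃ f ∈ F, c - f ∈ W.fineSelmerInfty κ ∧ (p : ℕ) • (c - f) = 0) :
    Set.Finite {s : selmerAc W p κ 𝔭 S | p • s = 0} := by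
  obtain ⟨F, hF, hmod⟩ := hmod
  exact finite_torsion_of_finite_modulo (W.fineSelmerInfty κ) (selmerAc W p κ 𝔭 S) p hfine F hF hmod

end Cut

/-! ## §5 Glue to the crux BY NAME, and the EQUIV / WEAKER certificates -/

section Glue

open NumberField IsDedekindDomain Field WeierstrassCurve
open Literature.NumberTheory.EllipticCurves Literature.NumberTheory.EllipticCurves.IwasawaAlgebra
open Literature.NumberTheory.EllipticCurves.ZpExtension Literature.NumberTheory.EllipticCurves.GreenbergSelmer
open Summit.BirchSwinnertonDyer.Rank1Residual.X11b Summit.BirchSwinnertonDyer.Rank1Residual.X11b.AcSelmer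
open Summit.BirchSwinnertonDyer.BirchSwinnertonDyer.Theorems
open Summit.BirchSwinnertonDyer.BirchSwinnertonDyer.Theorems.UniversalToricDescentAcDualMuZero

/-- **B1 ∧ B2 ⟹ crux `TwinAlgMuZeroAtThree`, BY NAME, both buckets.**  Bottom invariants finite and no bottom universal norms
from some layer ⟹ `Sel_𝔭′(K_∞, E′[3^∞])[3]` finite (`finite_pTorsion_of_bottomNorms`) ⟹ `X_(∅,0)` is `Λ`-torsion with a
norm-one coefficient of `Ch·R₀⟦T⟧` (route receptacle `isTorsion_and_exists_generator_of_finite_pTorsion`).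
[cite: GreenbergVatsal2000, §2 Prop. (2.8)] [cite: Washington1997, §13.2] -/
theorem TwinAlgMuZeroAtThree_of_bottom (h1 : BottomInvariantsFiniteAtThree) (h2 : BottomNormsVanishAtThree) :
    Summit.BirchSwinnertonDyer.BirchSwinnertonDyer.Theses.UniversalToricDescent.TwinAlgMuZeroAtThree := by
  intro W' _ _ N' _ K _ _ Dt' hbucket hsurj hN hK hH hodd κ hκ γ _ 𝔭 h𝔭 he hf 𝔭' h𝔭' hne
  have hfix := h1 W' N' K Dt' hbucket hsurj hN hK hH hodd κ hκ γ 𝔭 h𝔭 he hf 𝔭' h𝔭' hne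
  have hnorm := h2 W' N' K Dt' hbucket hsurj hN hK hH hodd κ hκ γ 𝔭 h𝔭 he hf 𝔭' h𝔭' hne
  exact isTorsion_and_exists_generator_of_finite_pTorsion (W'.baseChange K) 3 κ 𝔭' ∅ γ Set.finite_empty
    (finite_pTorsion_of_bottomNorms (W'.baseChange K) 3 κ 𝔭' ∅ γ hfix hnorm)

/-- **B2 ⟹ crux `TwinAlgMuZeroAtThree`, BY NAME, both buckets** — the node's composition from its ONE open piece (B1 is the tree
theorem `bottomInvariantsFiniteAtThree_holds`). [cite: GreenbergVatsal2000, §2 Prop. (2.8)] [cite: GreenbergLNM1716, §1 p. 60] -/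
theorem TwinAlgMuZeroAtThree_of (h2 : BottomNormsVanishAtThree) :
    Summit.BirchSwinnertonDyer.BirchSwinnertonDyer.Theses.UniversalToricDescent.TwinAlgMuZeroAtThree :=
  TwinAlgMuZeroAtThree_of_bottom bottomInvariantsFiniteAtThree_holds h2

/-- **EQUIV certificate: crux ⟹ B1 ∧ B2** (so the node is an EQUIVALENT reformulation, tagged as such; its children are the
decomposition FINE‴ ∧ QUOT‴ below and the card's (ii-1)/(ii-2)). [cite: Washington1997, §13.2] -/
theorem bottom_of_crux
    (h : Summit.BirchSwinnertonDyer.BirchSwinnertonDyer.Theses.UniversalToricDescent.TwinAlgMuZeroAtThree) :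
    BottomInvariantsFiniteAtThree ∧ BottomNormsVanishAtThree := by
  constructor
  · intro W' _ _ N' _ K _ _ Dt' hbucket hsurj hN hK hH hodd κ hκ γ _ 𝔭 h𝔭 he hf 𝔭' h𝔭' hne
    obtain ⟨htors, g, hg, hi⟩ := h W' N' K Dt' hbucket hsurj hN hK hH hodd κ hκ γ 𝔭 h𝔭 he hf 𝔭' h𝔭' hne
    exact (bottomNorms_of_finite_pTorsion (W'.baseChange K) 3 κ 𝔭' ∅ γ
      (finite_pTorsion_of_isTorsion_of_exists_generator (W'.baseChange K) 3 κ 𝔭' ∅ γ Set.finite_empty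
        htors ⟨g, hg, hi⟩)).1
  · intro W' _ _ N' _ K _ _ Dt' hbucket hsurj hN hK hH hodd κ hκ γ _ 𝔭 h𝔭 he hf 𝔭' h𝔭' hne
    obtain ⟨htors, g, hg, hi⟩ := h W' N' K Dt' hbucket hsurj hN hK hH hodd κ hκ γ 𝔭 h𝔭 he hf 𝔭' h𝔭' hne
    exact (bottomNorms_of_finite_pTorsion (W'.baseChange K) 3 κ 𝔭' ∅ γ
      (finite_pTorsion_of_isTorsion_of_exists_generator (W'.baseChange K) 3 κ 𝔭' ∅ γ Set.finite_empty
        htors ⟨g, hg, hi⟩)).2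

/-- **The node's net content, kernel-checked: crux `TwinAlgMuZeroAtThree` ⟺ B2 (no bottom universal norms from some layer).**
[cite: GreenbergLNM1716, §1 p. 60] [cite: Washington1997, §13.2] -/
theorem TwinAlgMuZeroAtThree_iff_bottomNormsVanish :
    Summit.BirchSwinnertonDyer.BirchSwinnertonDyer.Theses.UniversalToricDescent.TwinAlgMuZeroAtThree ↔
      BottomNormsVanishAtThree :=
  ⟨fun h ↦ (bottom_of_crux h).2, TwinAlgMuZeroAtThree_of⟩


/-- **The cut: FINE‴ ∧ QUOT‴ ⟹ crux, BY NAME** (the EQUIV node's typed decomposition into two WEAKER pieces).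
[cite: GreenbergVatsal2000, §2 Prop. (2.8)] [cite: MazurRubin2004, Thm. 2.3.4 (shape)] -/
theorem TwinAlgMuZeroAtThree_of_cut (hF : FineSelmerThreeTorsionFiniteAtThree)
    (hQ : SelmerModFineThreeTorsionFiniteAtThree) :
    Summit.BirchSwinnertonDyer.BirchSwinnertonDyer.Theses.UniversalToricDescent.TwinAlgMuZeroAtThree := by
  intro W' _ _ N' _ K _ _ Dt' hbucket hsurj hN hK hH hodd κ hκ γ _ 𝔭 h𝔭 he hf 𝔭' h𝔭' hne
  have hfine := hF W' N' K Dt' hbucket hsurj hN hK hH hodd κ hκ γ 𝔭 h𝔭 he hf 𝔭' h𝔭' hne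
  have hmod := hQ W' N' K Dt' hbucket hsurj hN hK hH hodd κ hκ γ 𝔭 h𝔭 he hf 𝔭' h𝔭' hne
  exact isTorsion_and_exists_generator_of_finite_pTorsion (W'.baseChange K) 3 κ 𝔭' ∅ γ Set.finite_empty
    (finite_torsionBy_of_fine_of_modFine (W'.baseChange K) 3 κ 𝔭' ∅ hfine hmod)

/-- **crux ⟹ QUOT‴** (QUOT‴ is WEAKER: take `F = Sel[3]` itself). [cite: Washington1997, §13.2] -/
theorem modFine_of_crux
    (h : Summit.BirchSwinnertonDyer.BirchSwinnertonDyer.Theses.UniversalToricDescent.TwinAlgMuZeroAtThree) :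
    SelmerModFineThreeTorsionFiniteAtThree := by
  intro W' _ _ N' _ K _ _ Dt' hbucket hsurj hN hK hH hodd κ hκ γ _ 𝔭 h𝔭 he hf 𝔭' h𝔭' hne
  obtain ⟨htors, g, hg, hi⟩ := h W' N' K Dt' hbucket hsurj hN hK hH hodd κ hκ γ 𝔭 h𝔭 he hf 𝔭' h𝔭' hne
  have hfin := finite_pTorsion_of_isTorsion_of_exists_generator (W'.baseChange K) 3 κ 𝔭' ∅ γ Set.finite_empty
    htors ⟨g, hg, hi⟩
  refine ⟨(fun s : selmerAc (W'.baseChange K) 3 κ 𝔭' ∅ => (s : (W'.baseChange K).subgroupH1 3 κ.kerSubgroup)) ''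
      {s | (3 : ℕ) • s = 0}, hfin.image _, fun c hc h3 => ?_⟩
  refine ⟨c, ⟨⟨c, hc⟩, ?_, rfl⟩, ?_, ?_⟩
  · show (3 : ℕ) • (⟨c, hc⟩ : selmerAc (W'.baseChange K) 3 κ 𝔭' ∅) = 0
    exact Subtype.ext (by simpa using h3)
  · rw [sub_self]; exact AddSubgroup.zero_mem _
  · rw [sub_self, smul_zero]

/-- **crux ⟹ FINE‴** (FINE‴ is WEAKER; as in node `fine-selmer-cut`). [cite: Washington1997, §13.2] -/
theorem fine_of_crux
    (h : Summit.BirchSwinnertonDyer.BirchSwinnertonDyer.Theses.UniversalToricDescent.TwinAlgMuZeroAtThree) :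
    FineSelmerThreeTorsionFiniteAtThree := by
  intro W' _ _ N' _ K _ _ Dt' hbucket hsurj hN hK hH hodd κ hκ γ _ 𝔭 h𝔭 he hf 𝔭' h𝔭' hne
  obtain ⟨htors, g, hg, hi⟩ := h W' N' K Dt' hbucket hsurj hN hK hH hodd κ hκ γ 𝔭 h𝔭 he hf 𝔭' h𝔭' hne
  have hfin := finite_pTorsion_of_isTorsion_of_exists_generator (W'.baseChange K) 3 κ 𝔭' ∅ γ Set.finite_empty
    htors ⟨g, hg, hi⟩
  -- pass to the smaller subgroup `Sel₀ ≤ Sel_𝔭′`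
  have hle := fineSelmerInfty_le_selmerAc (W'.baseChange K) 3 κ 𝔭' h𝔭' ∅
  let ι : (W'.baseChange K).fineSelmerInfty κ → selmerAc (W'.baseChange K) 3 κ 𝔭' ∅ := fun s => ⟨s.1, hle s.2⟩
  have hι : Function.Injective ι := by
    intro a b hab
    apply Subtype.ext
    have h1 : ((ι a : selmerAc (W'.baseChange K) 3 κ 𝔭' ∅) : (W'.baseChange K).subgroupH1 3 κ.kerSubgroup) =
        ((ι b : selmerAc (W'.baseChange K) 3 κ 𝔭' ∅) : (W'.baseChange K).subgroupH1 3 κ.kerSubgroup) :=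
      congrArg Subtype.val hab
    exact h1
  refine Set.Finite.of_finite_image (hfin.subset ?_) hι.injOn
  rintro _ ⟨s, hs, rfl⟩
  have hs' : (3 : ℕ) • (s : (W'.baseChange K).subgroupH1 3 κ.kerSubgroup) = 0 := by
    have h1 := congrArg Subtype.val hs
    simpa using h1
  show (3 : ℕ) • ι s = 0
  exact Subtype.ext (by simpa [ι] using hs')

end Glue

/-! ## §6 Registered stubs and the composition from stubs -/

section Stubs

/-- B2 (the load-bearing piece: no bottom universal norms; EQUIVALENT to the crux — `TwinAlgMuZeroAtThree_iff_bottomNormsVanish`). -/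
theorem stub_bottomNormsVanish : BottomNormsVanishAtThree := by
  sorry

/-- FINE‴ (shared with node `fine-selmer-cut`). -/
theorem stub_fineSelmerTorsionFinite : FineSelmerThreeTorsionFiniteAtThree := by
  sorry

/-- QUOT‴ (the `𝔭′`-visible part; two-row explicit reciprocity). -/
theorem stub_selmerModFineTorsionFinite : SelmerModFineThreeTorsionFiniteAtThree := by
  sorry

/-- The crux from the registered stubs (universal-norm form). -/
theorem TwinAlgMuZeroAtThree_of_stubs :
    Summit.BirchSwinnertonDyer.BirchSwinnertonDyer.Theses.UniversalToricDescent.TwinAlgMuZeroAtThree :=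
  TwinAlgMuZeroAtThree_of stub_bottomNormsVanish

/-- The crux from the registered stubs (cut form). -/
theorem TwinAlgMuZeroAtThree_of_cut_stubs :
    Summit.BirchSwinnertonDyer.BirchSwinnertonDyer.Theses.UniversalToricDescent.TwinAlgMuZeroAtThree :=
  TwinAlgMuZeroAtThree_of_cut stub_fineSelmerTorsionFinite stub_selmerModFineTorsionFinite

end Stubs

end Summit.BirchSwinnertonDyer.BirchSwinnertonDyer.Cruxes.TwinAlgMuZeroAtThree.UniversalNormDefect
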